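import Literature.Analysis.FluidPDE.ConstantinDirectionDissipationProofs
import Summits.NavierStokesRegularity.NavierStokesRegularity.Theorems.SlicedKelvinPlanarFluxAPrioriFoldPointwise
import HarnessLib

/-!
# Crux `SlicedKelvin.PlanarFluxAPriori` (stmt-NavierStokesRegularity-15600), line `Sketch`:
  the level-set multiplier calculus for a vorticity component `f = ⟪ω, n⟫` (slice identity)

Support file 1 (`--supports stmt-NavierStokesRegularity-15600`) for the registered stub
`stub_apexLevelSetDissipation` (Constantin-type level-set dissipation budget for `ω·n`).

The method is P. Constantin, *Navier–Stokes equations and area of interfaces*, Comm. Math. Phys.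
**129** (1990) 241–266, §3, (3.7)–(3.16): a scalar `f` transported and diffused by the flow,
`∂ₜf + u·∇f − νΔf = r`, is multiplied by `ψ G'(f)` for a convex `C²` multiplier `G` with bounded
derivative and a compactly supported weight `ψ`; two integrations by parts give the **slice identity**

  `∫ ψ G'(f) (νΔf − u·∇f + r) = −ν ∫ ψ G''(f) |∇f|² + ∫ [ν (Δψ) G(f) + G(f) (u·∇ψ) + ψ G'(f) r]`

(viscous part: `∫ψG'(f)Δf = −∫ψG''(f)|∇f|² − ∫G'(f)∇ψ·∇f` and `∫G'(f)∇ψ·∇f = ∫∇ψ·∇(G∘f) = −∫(Δψ)G(f)`;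
transport part: `−∫ψG'(f)u·∇f = −∫ψ u·∇(G∘f) = ∫(G∘f) u·∇ψ` for `div u = 0`). Here the scalar is a
fixed component `f = ⟪ω, n⟫` of a vector field `ω` (later: the vorticity), the equation being the
`n`-component of `V = νΔω − (u·∇)ω + (ω·∇)u`, so that `r = ⟪(ω·∇)u, n⟫`; the file proves the slice
identity in this form (`levelSet_slice_identity`, generic in `G`, `G'`, `G''`), by the whole-space
integration-by-parts identities of `Literature/Analysis/FluidPDE/WholeSpaceIBP`
(`integral_inner_laplacian_add_eq_zero`, `integral_mul_divergence_add_eq_zero_left`), exactly as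
the in-tree regularised-modulus version `integral_mul_inner_laplacian_div_regN` /
`integral_mul_inner_convect_div_regN` (`ConstantinDirectionDissipationCalculus`) — adapted from those.
The dissipation density is written with the operator norm of the differential of `f`,
`|∇f|² = ‖Df(x)‖²` (`levelSet_sum_sq_apply_eq_norm_sq`: `Σᵢ (L bᵢ)² = ‖L‖²` for a linear form `L`
on Euclidean space and an orthonormal basis `b`).

## References

* P. Constantin, *Navier–Stokes equations and area of interfaces*, Comm. Math. Phys. 129 (1990)
  241–266, §3, (3.7)–(3.16).
-/

noncomputable section

namespace Summit.NavierStokesRegularity.NavierStokesRegularity.Theorems.SlicedKelvinPlanarFluxAPriori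

-- the summit and its single sub-problem share the name (CONVENTIONS §1)
set_option linter.dupNamespace false

open MeasureTheory Set Function Filter Metric Literature.Analysis.FluidPDE
open scoped RealInnerProductSpace ENNReal NNReal Laplacian Topology

/-! ### Linear algebra and first-order calculus of a component `⟪g, n⟫` -/

section Component

/-- For a linear form `L` on `ℝ³` and an orthonormal basis `b`, `Σᵢ (L bᵢ)² = ‖L‖²` (Riesz
representation `L = ⟪a, ·⟫`, `‖L‖ = ‖a‖`, and Parseval). -/
theorem levelSet_sum_sq_apply_eq_norm_sq {ι : Type*} [Fintype ι]
    (b : OrthonormalBasis ι ℝ (EuclideanSpace ℝ (Fin 3))) (L : EuclideanSpace ℝ (Fin 3) →L[ℝ] ℝ) :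
    ∑ i, (L (b i)) ^ 2 = ‖L‖ ^ 2 := by
  set a := (InnerProductSpace.toDual ℝ (EuclideanSpace ℝ (Fin 3))).symm L with ha
  have hL : ∀ y, L y = ⟪a, y⟫ := fun y => by
    rw [ha, InnerProductSpace.toDual_symm_apply]
  have hn : ‖L‖ = ‖a‖ := by rw [ha, LinearIsometryEquiv.norm_map]
  simp_rw [hL, hn]
  exact b.sum_sq_inner_left a

/-- `D⟪g, n⟫(x) = ⟪n, ·⟫ ∘ Dg(x)` as continuous linear maps (`hasFDerivAt_inner_const` of the
sibling file `…FoldPointwise`). -/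
theorem levelSet_fderiv_inner_const_eq
    {g : EuclideanSpace ℝ (Fin 3) → EuclideanSpace ℝ (Fin 3)} {x : EuclideanSpace ℝ (Fin 3)}
    (hg : DifferentiableAt ℝ g x) (n : EuclideanSpace ℝ (Fin 3)) :
    fderiv ℝ (fun z => ⟪g z, n⟫) x = (innerSL ℝ n).comp (fderiv ℝ g x) :=
  (hasFDerivAt_inner_const hg.hasFDerivAt n).fderiv

/-- `D⟪g, n⟫(x)[e] = ⟪Dg(x) e, n⟫`. -/
theorem levelSet_fderiv_inner_const_apply
    {g : EuclideanSpace ℝ (Fin 3) → EuclideanSpace ℝ (Fin 3)} {x : EuclideanSpace ℝ (Fin 3)}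
    (hg : DifferentiableAt ℝ g x) (n e : EuclideanSpace ℝ (Fin 3)) :
    fderiv ℝ (fun z => ⟪g z, n⟫) x e = ⟪fderiv ℝ g x e, n⟫ := by
  rw [levelSet_fderiv_inner_const_eq hg n, ContinuousLinearMap.comp_apply, innerSL_apply_apply,
    real_inner_comm]

end Component

/-! ### One-variable multipliers given by their derivatives -/

section OneVariable

variable {G G' : ℝ → ℝ}

/-- A function with a derivative everywhere is continuous. -/
theorem levelSet_continuous_of_hasDerivAt (hG : ∀ s, HasDerivAt G (G' s) s) : Continuous G :=
  continuous_iff_continuousAt.2 fun s => (hG s).continuousAt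

/-- A function with a continuous derivative everywhere is `C¹`. -/
theorem levelSet_contDiff_one_of_hasDerivAt (hG : ∀ s, HasDerivAt G (G' s) s)
    (hG'c : Continuous G') : ContDiff ℝ 1 G := by
  have hd : deriv G = G' := funext fun s => (hG s).deriv
  exact contDiff_one_iff_deriv.2 ⟨fun s => (hG s).differentiableAt, hd ▸ hG'c⟩

/-- Chain rule `D(G ∘ f)(x) = G'(f x) · Df(x)` for a differentiable scalar field `f`. -/
theorem levelSet_hasFDerivAt_comp (hG : ∀ s, HasDerivAt G (G' s) s)
    {f : EuclideanSpace ℝ (Fin 3) → ℝ} {x : EuclideanSpace ℝ (Fin 3)} (hf : DifferentiableAt ℝ f x) :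
    HasFDerivAt (fun y => G (f y)) (G' (f x) • fderiv ℝ f x) x :=
  (hG (f x)).comp_hasFDerivAt x hf.hasFDerivAt

/-- Applied chain rule `D(G ∘ f)(x)[e] = G'(f x) · Df(x)[e]`. -/
theorem levelSet_fderiv_comp_apply (hG : ∀ s, HasDerivAt G (G' s) s)
    {f : EuclideanSpace ℝ (Fin 3) → ℝ} {x : EuclideanSpace ℝ (Fin 3)} (hf : DifferentiableAt ℝ f x)
    (e : EuclideanSpace ℝ (Fin 3)) :
    fderiv ℝ (fun y => G (f y)) x e = G' (f x) * fderiv ℝ f x e := by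
  rw [(levelSet_hasFDerivAt_comp hG hf).fderiv, _root_.FunLike.coe_smul, Pi.smul_apply, smul_eq_mul]

end OneVariable

/-! ### The slice identities for a component `f = ⟪ω, n⟫` -/

section Slice

variable {ω : EuclideanSpace ℝ (Fin 3) → EuclideanSpace ℝ (Fin 3)} {ψ : EuclideanSpace ℝ (Fin 3) → ℝ}
  {G G' G'' : ℝ → ℝ}

/-- **The viscous identity** (Constantin 1990, §3, the diffusion part of (3.9)–(3.12)): for
`ω ∈ C²`, `ψ ∈ C²_c`, a multiplier `G` with `G' = dG/ds`, `G'' = dG'/ds` continuous, a fixed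
vector `n` and `f = ⟪ω, n⟫`,
`∫ ψ G'(f) ⟪Δω, n⟫ = −∫ ψ G''(f) ‖Df‖² + ∫ (Δψ) G(f)`:
integrate by parts once against `(ψ G'(f)) n` (`∫⟪Δω, W⟫ = −Σᵢ∫⟪∂ᵢω, ∂ᵢW⟫`, `⟪∂ᵢω, n⟫ = ∂ᵢf`),
and once more in the cross term `Σᵢ ∫ ∂ᵢψ G'(f) ∂ᵢf = Σᵢ ∫ ∂ᵢψ ∂ᵢ(G∘f) = −∫ (Δψ) G(f)`. -/
theorem levelSet_integral_viscous (hω : ContDiff ℝ 2 ω) (hψ : ContDiff ℝ 2 ψ)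
    (hψc : HasCompactSupport ψ) (hG : ∀ s, HasDerivAt G (G' s) s)
    (hG' : ∀ s, HasDerivAt G' (G'' s) s) (hG''c : Continuous G'') (n : EuclideanSpace ℝ (Fin 3)) :
    ∫ x, ψ x * (G' ⟪ω x, n⟫ * ⟪(Δ ω) x, n⟫) =
      -(∫ x, ψ x * (G'' ⟪ω x, n⟫ * ‖fderiv ℝ (fun z => ⟪ω z, n⟫) x‖ ^ 2)) +
        ∫ x, (Δ ψ) x * G ⟪ω x, n⟫ := by
  set b := stdOrthonormalBasis ℝ (EuclideanSpace ℝ (Fin 3)) with hb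
  set f : EuclideanSpace ℝ (Fin 3) → ℝ := fun z => ⟪ω z, n⟫ with hf
  -- regularity
  have hω1 : ContDiff ℝ 1 ω := hω.of_le one_le_two
  have hψ1 : ContDiff ℝ 1 ψ := hψ.of_le one_le_two
  have hf2 : ContDiff ℝ 2 f := hω.inner ℝ contDiff_const
  have hf1 : ContDiff ℝ 1 f := hf2.of_le one_le_two
  have hG'c : Continuous G' := levelSet_continuous_of_hasDerivAt hG'
  have hGc : Continuous G := levelSet_continuous_of_hasDerivAt hG
  have hG1 : ContDiff ℝ 1 G := levelSet_contDiff_one_of_hasDerivAt hG hG'c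
  have hG'1 : ContDiff ℝ 1 G' := levelSet_contDiff_one_of_hasDerivAt hG' hG''c
  have hGf1 : ContDiff ℝ 1 fun y => G (f y) := hG1.comp hf1
  have hG'f1 : ContDiff ℝ 1 fun y => G' (f y) := hG'1.comp hf1
  have hfd : ∀ x, DifferentiableAt ℝ f x := fun x => hf1.differentiable one_ne_zero x
  -- derivative formulas
  have hDf : ∀ x e, fderiv ℝ f x e = ⟪fderiv ℝ ω x e, n⟫ := fun x e =>
    levelSet_fderiv_inner_const_apply (hω1.differentiable one_ne_zero x) n e
  set W : EuclideanSpace ℝ (Fin 3) → EuclideanSpace ℝ (Fin 3) := fun x => (ψ x * G' (f x)) • n with hW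
  have hW1 : ContDiff ℝ 1 W := (hψ1.mul hG'f1).smul contDiff_const
  have hWc : HasCompactSupport W := HasCompactSupport.intro hψc fun x hx => by
    simp [hW, image_eq_zero_of_notMem_tsupport hx]
  have hDW : ∀ x e, fderiv ℝ W x e =
      (fderiv ℝ ψ x e * G' (f x) + ψ x * (G'' (f x) * fderiv ℝ f x e)) • n := by
    intro x e
    have h1 : HasFDerivAt ψ (fderiv ℝ ψ x) x := (hψ1.differentiable one_ne_zero x).hasFDerivAt
    have h2 : HasFDerivAt (fun y => G' (f y)) (G'' (f x) • fderiv ℝ f x) x :=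
      levelSet_hasFDerivAt_comp hG' (hfd x)
    have h3 : HasFDerivAt W
        ((ψ x • (G'' (f x) • fderiv ℝ f x) + G' (f x) • fderiv ℝ ψ x).smulRight n) x :=
      (h1.mul h2).smul_const n
    rw [h3.fderiv, ContinuousLinearMap.smulRight_apply]
    congr 1
    simp only [_root_.add_apply, _root_.FunLike.coe_smul, Pi.smul_apply, smul_eq_mul]
    ring
  -- first integration by parts
  have ibp1 := integral_inner_laplacian_add_eq_zero b hω hW1 (Or.inr hWc)
  have hpair : ∀ x, ⟪(Δ ω) x, W x⟫ = ψ x * (G' (f x) * ⟪(Δ ω) x, n⟫) := fun x => by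
    simp only [hW, real_inner_smul_right]
    ring
  have hterm : ∀ i x, ⟪fderiv ℝ ω x (b i), fderiv ℝ W x (b i)⟫ =
      ψ x * (G'' (f x) * fderiv ℝ f x (b i) ^ 2)
        + fderiv ℝ ψ x (b i) * (G' (f x) * fderiv ℝ f x (b i)) := by
    intro i x
    rw [hDW, real_inner_smul_right, ← hDf]
    ring
  -- continuity and integrability
  have hcψ : Continuous ψ := hψ.continuous
  have hcDψ : ∀ i, Continuous fun x => fderiv ℝ ψ x (b i) := fun i =>
    (hψ1.continuous_fderiv one_ne_zero).clm_apply continuous_const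
  have hcDf : ∀ i, Continuous fun x => fderiv ℝ f x (b i) := fun i =>
    (hf1.continuous_fderiv one_ne_zero).clm_apply continuous_const
  have hcGf : Continuous fun x => G (f x) := hGc.comp hf1.continuous
  have hcG'f : Continuous fun x => G' (f x) := hG'c.comp hf1.continuous
  have hcG''f : Continuous fun x => G'' (f x) := hG''c.comp hf1.continuous
  have hA : ∀ i, Integrable fun x => ψ x * (G'' (f x) * fderiv ℝ f x (b i) ^ 2) := fun i =>
    (hcψ.mul (hcG''f.mul ((hcDf i).pow 2))).integrable_of_hasCompactSupport hψc.mul_right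
  have hB : ∀ i, Integrable fun x => fderiv ℝ ψ x (b i) * (G' (f x) * fderiv ℝ f x (b i)) :=
    fun i => ((hcDψ i).mul (hcG'f.mul (hcDf i))).integrable_of_hasCompactSupport
      (hψc.fderiv_apply (𝕜 := ℝ) (b i)).mul_right
  -- the sum of the first-order pairings
  have hsum : ∑ i, ∫ x, ⟪fderiv ℝ ω x (b i), fderiv ℝ W x (b i)⟫ =
      (∫ x, ψ x * (G'' (f x) * ∑ i, fderiv ℝ f x (b i) ^ 2)) +
        ∑ i, ∫ x, fderiv ℝ ψ x (b i) * (G' (f x) * fderiv ℝ f x (b i)) := by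
    have hi : ∀ i, ∫ x, ⟪fderiv ℝ ω x (b i), fderiv ℝ W x (b i)⟫ =
        (∫ x, ψ x * (G'' (f x) * fderiv ℝ f x (b i) ^ 2)) +
          ∫ x, fderiv ℝ ψ x (b i) * (G' (f x) * fderiv ℝ f x (b i)) := fun i => by
      rw [← integral_add (hA i) (hB i)]
      exact integral_congr_ae (Eventually.of_forall fun x => hterm i x)
    rw [Finset.sum_congr rfl fun i _ => hi i, Finset.sum_add_distrib,
      ← integral_finsetSum _ fun i _ => hA i]
    congr 1
    refine integral_congr_ae (Eventually.of_forall fun x => ?_)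
    simp only [Finset.mul_sum]
  -- second integration by parts (scalar, onto `ψ`)
  have ibp2 := integral_inner_laplacian_add_eq_zero b (F' := ℝ) hψ hGf1 (Or.inl hψc)
  have ibp2' : (∫ x, (Δ ψ) x * G (f x)) +
      ∑ i, ∫ x, fderiv ℝ ψ x (b i) * (G' (f x) * fderiv ℝ f x (b i)) = 0 := by
    have e1 : ∫ x, ⟪(Δ ψ) x, G (f x)⟫ = ∫ x, (Δ ψ) x * G (f x) :=
      integral_congr_ae (Eventually.of_forall fun x => by simp [mul_comm])
    have e2 : ∀ i, ∫ x, ⟪fderiv ℝ ψ x (b i), fderiv ℝ (fun y => G (f y)) x (b i)⟫ =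
        ∫ x, fderiv ℝ ψ x (b i) * (G' (f x) * fderiv ℝ f x (b i)) := fun i =>
      integral_congr_ae (Eventually.of_forall fun x => by
        beta_reduce
        rw [levelSet_fderiv_comp_apply hG (hfd x)]
        simp [mul_comm])
    rw [← e1, ← Finset.sum_congr rfl fun i _ => e2 i]
    exact ibp2
  -- the operator norm of `Df`
  have hnorm : ∀ x, ‖fderiv ℝ f x‖ ^ 2 = ∑ i, fderiv ℝ f x (b i) ^ 2 := fun x =>
    (levelSet_sum_sq_apply_eq_norm_sq b _).symm
  simp only [hnorm]
  -- assemble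
  have e0 : ∫ x, ψ x * (G' (f x) * ⟪(Δ ω) x, n⟫) = ∫ x, ⟪(Δ ω) x, W x⟫ :=
    integral_congr_ae (Eventually.of_forall fun x => (hpair x).symm)
  rw [e0]
  linarith [ibp1, hsum, ibp2']

/-- **The transport identity** (Constantin 1990, §3, the advection part of (3.9)–(3.12)): for
`ω, ψ ∈ C¹`, `ψ` compactly supported, a divergence-free `v ∈ C¹`, a multiplier `G` with continuous
derivative `G'`, a fixed vector `n` and `f = ⟪ω, n⟫`,
`∫ ψ G'(f) ⟪Dω[v], n⟫ = ∫ ψ (v·∇)(G∘f) = −∫ (G∘f) (v·∇)ψ`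
(`∫ ⟪v, ∇(ψ (G∘f))⟫ = −∫ ψ (G∘f) div v = 0`). -/
theorem levelSet_integral_transport (hω : ContDiff ℝ 1 ω) (hψ : ContDiff ℝ 1 ψ)
    (hψc : HasCompactSupport ψ) (hG : ∀ s, HasDerivAt G (G' s) s) (hG'c : Continuous G')
    {v : EuclideanSpace ℝ (Fin 3) → EuclideanSpace ℝ (Fin 3)} (hv : ContDiff ℝ 1 v)
    (hdiv : VectorCalculus.IsDivFree v) (n : EuclideanSpace ℝ (Fin 3)) :
    ∫ x, ψ x * (G' ⟪ω x, n⟫ * ⟪fderiv ℝ ω x (v x), n⟫) =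
      -∫ x, G ⟪ω x, n⟫ * fderiv ℝ ψ x (v x) := by
  set f : EuclideanSpace ℝ (Fin 3) → ℝ := fun z => ⟪ω z, n⟫ with hf
  have hf1 : ContDiff ℝ 1 f := hω.inner ℝ contDiff_const
  have hfd : ∀ x, DifferentiableAt ℝ f x := fun x => hf1.differentiable one_ne_zero x
  have hGc : Continuous G := levelSet_continuous_of_hasDerivAt hG
  have hG1 : ContDiff ℝ 1 G := levelSet_contDiff_one_of_hasDerivAt hG hG'c
  have hGf1 : ContDiff ℝ 1 fun y => G (f y) := hG1.comp hf1
  have hDf : ∀ x e, fderiv ℝ f x e = ⟪fderiv ℝ ω x e, n⟫ := fun x e =>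
    levelSet_fderiv_inner_const_apply (hω.differentiable one_ne_zero x) n e
  set θ : EuclideanSpace ℝ (Fin 3) → ℝ := fun y => ψ y * G (f y) with hθ
  have hθ1 : ContDiff ℝ 1 θ := hψ.mul hGf1
  have hθc : HasCompactSupport θ := hψc.mul_right
  have h := integral_mul_divergence_add_eq_zero_left hθ1 hv hθc
  have hdiv0 : ∫ x, θ x * VectorCalculus.divergence v x = 0 := by
    simp [hdiv _]
  rw [hdiv0, zero_add] at h
  have hDθ : ∀ x, ⟪v x, gradient θ x⟫ =
      G (f x) * fderiv ℝ ψ x (v x) + ψ x * (G' (f x) * ⟪fderiv ℝ ω x (v x), n⟫) := by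
    intro x
    have hGfx : HasFDerivAt (fun y => G (f y)) (G' (f x) • fderiv ℝ f x) x :=
      levelSet_hasFDerivAt_comp hG (hfd x)
    rw [gradient, real_inner_comm, InnerProductSpace.toDual_symm_apply, hθ,
      fderiv_fun_mul (hψ.differentiable one_ne_zero x) hGfx.differentiableAt, hGfx.fderiv]
    simp only [_root_.add_apply, _root_.FunLike.coe_smul, Pi.smul_apply, smul_eq_mul, hDf]
    ring
  simp_rw [hDθ] at h
  -- integrability of the two pieces
  have hcGf : Continuous fun x => G (f x) := hGc.comp hf1.continuous
  have hcG'f : Continuous fun x => G' (f x) := hG'c.comp hf1.continuous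
  have hi₁ : Integrable fun x => G (f x) * fderiv ℝ ψ x (v x) := by
    refine (hcGf.mul ((hψ.continuous_fderiv one_ne_zero).clm_apply hv.continuous))
      |>.integrable_of_hasCompactSupport ?_
    refine (hψc.fderiv (𝕜 := ℝ)).mono fun x hx => ?_
    contrapose! hx
    simp only [mem_support, not_not] at hx
    simp [hx]
  have hi₂ : Integrable fun x => ψ x * (G' (f x) * ⟪fderiv ℝ ω x (v x), n⟫) :=
    (hψ.continuous.mul (hcG'f.mul (((hω.continuous_fderiv one_ne_zero).clm_apply
      hv.continuous).inner continuous_const))).integrable_of_hasCompactSupport hψc.mul_right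
  rw [integral_add hi₁ hi₂] at h
  linarith

/-- **The slice identity for a vorticity component** (Constantin 1990, §3, (3.9)–(3.12) for the
scalar `f = ⟪ω, n⟫`, integrated in space against a weight): for `ω ∈ C²`, a divergence-free
`v ∈ C¹`, `ψ ∈ C²_c`, a fixed vector `n`, a `C²` multiplier `G` (with `G' = dG/ds`,
`G'' = dG'/ds` continuous) and any `ν`, writing `f = ⟪ω, n⟫` and `V = νΔω − Dω[v] + Dv[ω]`
(the right-hand side of the vorticity equation),
`∫ ψ G'(f) ⟪V, n⟫ = −ν ∫ ψ G''(f) ‖Df‖² + ∫ [ν (Δψ) G(f) + G(f) Dψ[v] + ψ G'(f) ⟪Dv[ω], n⟫]`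
(`levelSet_integral_viscous` and `levelSet_integral_transport`). -/
theorem levelSet_slice_identity : ∀ (ν : ℝ) (ω v : EuclideanSpace ℝ (Fin 3) → EuclideanSpace ℝ (Fin 3)) (ψ : EuclideanSpace ℝ (Fin 3) → ℝ) (n : EuclideanSpace ℝ (Fin 3)) (G G' G'' : ℝ → ℝ), ContDiff ℝ 2 ω → ContDiff ℝ 1 v → Literature.Analysis.FluidPDE.VectorCalculus.IsDivFree v → ContDiff ℝ 2 ψ → HasCompactSupport ψ → (∀ s, HasDerivAt G (G' s) s) → (∀ s, HasDerivAt G' (G'' s) s) → Continuous G'' → ∫ x, ψ x * (G' (inner ℝ (ω x) n) * inner ℝ (ν • Laplacian.laplacian ω x - fderiv ℝ ω x (v x) + fderiv ℝ v x (ω x)) n) = -(ν * ∫ x, ψ x * (G'' (inner ℝ (ω x) n) * ‖fderiv ℝ (fun z => inner ℝ (ω z) n) x‖ ^ 2)) + ∫ x, (ν * (Laplacian.laplacian ψ x * G (inner ℝ (ω x) n)) + G (inner ℝ (ω x) n) * fderiv ℝ ψ x (v x) + ψ x * (G' (inner ℝ (ω x) n) * inner ℝ (fderiv ℝ v x (ω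 x)) n)) := by
  intro ν ω v ψ n G G' G'' hω hv hdiv hψ hψc hG hG' hG''c
  set f : EuclideanSpace ℝ (Fin 3) → ℝ := fun z => ⟪ω z, n⟫ with hf
  have hω1 : ContDiff ℝ 1 ω := hω.of_le one_le_two
  have hψ1 : ContDiff ℝ 1 ψ := hψ.of_le one_le_two
  have hf1 : ContDiff ℝ 1 f := hω1.inner ℝ contDiff_const
  have hG'c : Continuous G' := levelSet_continuous_of_hasDerivAt hG'
  have hGc : Continuous G := levelSet_continuous_of_hasDerivAt hG
  -- pointwise splitting of the integrand
  have hpt : ∀ x, ψ x * (G' (f x) * ⟪ν • (Δ ω) x - fderiv ℝ ω x (v x) + fderiv ℝ v x (ω x), n⟫) =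
      ν * (ψ x * (G' (f x) * ⟪(Δ ω) x, n⟫))
        - ψ x * (G' (f x) * ⟪fderiv ℝ ω x (v x), n⟫)
        + ψ x * (G' (f x) * ⟪fderiv ℝ v x (ω x), n⟫) := by
    intro x
    rw [inner_add_left, inner_sub_left, real_inner_smul_left]
    ring
  -- integrability of the three pieces (continuous, compact support in `x`)
  have hcf : Continuous f := hf1.continuous
  have hcG'f : Continuous fun x => G' (f x) := hG'c.comp hcf
  have hcGf : Continuous fun x => G (f x) := hGc.comp hcf
  have hcG''f : Continuous fun x => G'' (f x) := hG''c.comp hcf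
  have hcΔ : Continuous (Δ ω) := continuous_laplacian hω
  have hcDω : Continuous fun x => fderiv ℝ ω x (v x) :=
    (hω1.continuous_fderiv one_ne_zero).clm_apply hv.continuous
  have hcDv : Continuous fun x => fderiv ℝ v x (ω x) :=
    (hv.continuous_fderiv one_ne_zero).clm_apply hω.continuous
  have hi₁ : Integrable fun x => ψ x * (G' (f x) * ⟪(Δ ω) x, n⟫) :=
    (hψ.continuous.mul (hcG'f.mul (hcΔ.inner continuous_const))).integrable_of_hasCompactSupport
      hψc.mul_right
  have hi₂ : Integrable fun x => ψ x * (G' (f x) * ⟪fderiv ℝ ω x (v x), n⟫) :=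
    (hψ.continuous.mul (hcG'f.mul (hcDω.inner continuous_const))).integrable_of_hasCompactSupport
      hψc.mul_right
  have hi₃ : Integrable fun x => ψ x * (G' (f x) * ⟪fderiv ℝ v x (ω x), n⟫) :=
    (hψ.continuous.mul (hcG'f.mul (hcDv.inner continuous_const))).integrable_of_hasCompactSupport
      hψc.mul_right
  -- the two identities
  have hvisc := levelSet_integral_viscous hω hψ hψc hG hG' hG''c n
  have htrans := levelSet_integral_transport hω1 hψ1 hψc hG hG'c hv hdiv n
  -- integrability of the remainder pieces
  have hΔc : HasCompactSupport (Δ ψ) :=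
    HasCompactSupport.intro hψc fun x hx => laplacian_eq_zero_of_notMem_tsupport hx
  have hr₁ : Integrable fun x => ν * ((Δ ψ) x * G (f x)) :=
    (((continuous_laplacian hψ).mul hcGf).integrable_of_hasCompactSupport hΔc.mul_right).const_mul ν
  have hr₂ : Integrable fun x => G (f x) * fderiv ℝ ψ x (v x) := by
    refine (hcGf.mul ((hψ1.continuous_fderiv one_ne_zero).clm_apply hv.continuous))
      |>.integrable_of_hasCompactSupport ?_
    refine (hψc.fderiv (𝕜 := ℝ)).mono fun x hx => ?_
    contrapose! hx
    simp only [mem_support, not_not] at hx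
    simp [hx]
  -- assemble
  have step1 : ∫ x, ψ x * (G' (f x) * ⟪ν • (Δ ω) x - fderiv ℝ ω x (v x) + fderiv ℝ v x (ω x), n⟫)
      = ∫ x, (ν * (ψ x * (G' (f x) * ⟪(Δ ω) x, n⟫))
          - ψ x * (G' (f x) * ⟪fderiv ℝ ω x (v x), n⟫)
          + ψ x * (G' (f x) * ⟪fderiv ℝ v x (ω x), n⟫)) :=
    integral_congr_ae (Eventually.of_forall hpt)
  rw [step1, integral_add ?_ hi₃, integral_sub ?_ hi₂, integral_const_mul, hvisc, htrans,
    integral_add ?_ hi₃, integral_add hr₁ hr₂, integral_const_mul]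
  · ring
  · exact hr₁.add hr₂
  · exact hi₁.const_mul ν
  · exact (hi₁.const_mul ν).sub hi₂

end Slice

end Summit.NavierStokesRegularity.NavierStokesRegularity.Theorems.SlicedKelvinPlanarFluxAPriori
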